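import Mathlib
import Summits.Schanuel.Schanuel.Theses.ExceptionalSubspaces
import Summits.Schanuel.Schanuel.Theorems.RigidCoreEndomorphismMovingLogTwo
import Summits.Schanuel.Schanuel.Theorems.RigidCoreSchanuelOnLogFreeCoreExpExceptionalLine

/-!
# Line `sector-split` (route `RigidCore`), skeleton v8: the endomorphism criterion for the π–LW residue

Prover file for the registered calibration stub `stub_endomorphismCriterion` of line `sector-split`
(axes refinement, lead c5) of crux `stmt-Schanuel-0970`
(`Summit.Schanuel.Schanuel.Theses.RigidCore.SchanuelOnLogFreeCore`, "(R)").  The line's residue 1′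
(`PiFreeOnAxes`: `π` is transcendental over `ℚ(e^a, e^{ib} : a, b ∈ ℚ̄ ∩ ℝ)`) has, at `d = 1`, the
cells "`π ⊥ e^α`, `α` a real or purely imaginary algebraic number".  The only SYMMETRIC handle on
such a cell is the theorem proved here, VERBATIM the support item stmt-Schanuel-9550
`ExceptionalSubspaces.EndomorphismCriterion` of the sibling route ExceptionalSubspaces:

  if `α` is algebraic and some ring endomorphism `j` of `ℂ` commuting with `exp` moves `α` off
  `{α, −α}`, then `π` and `e^α` are algebraically independent over `ℚ`.

(With `j = conj` this is the off-axes theorem; on the axes it needs an exotic `exp`-commuting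
endomorphism of `ℂ`, none of which is known — which is why residue 1′ is the arithmetic core.)

Proof.  `j(2πi) = ±2πi` and `j(i) = ±i` (`map_two_pi_I_eq_or`, tree file
`RigidCoreEndomorphismMovingLogTwo`), so `j π = ±π` and `j` maps `ℚ(π)` into itself; hence
"`e^α` algebraic over `ℚ(π)`" transports to "`e^{jα} = j(e^α)` algebraic over `ℚ(π)`".  The pair
`(α, jα)` is `ℚ`-free: `jα = qα` with `q ∈ ℚ ∖ {0, ±1}` would make the `jⁿα = qⁿα` infinitely many
roots of the minimal polynomial of `α`.  But for `ℚ`-free algebraic `α, β` the numbers `e^α, e^β`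
are not both algebraic over `ℚ(π)` (Lindemann–Weierstrass, tree theorem
`KernelTower.not_isAlgebraic_adjoin_pi_exp_pair`).  So `e^α` is transcendental over `ℚ(π)`, i.e.
`π ⊥ e^α` (`KernelTower.algebraicIndependent_pi_pair_iff`).
-/

noncomputable section

namespace Summit.Schanuel.Schanuel.Theorems.RigidCore

open Summit.Schanuel.Schanuel.Theses
open IntermediateField

namespace EndoCriterion

/-- An `exp`-commuting ring endomorphism of `ℂ` maps `π` to `±π`. [folklore] -/
theorem map_pi_eq_or (j : ℂ →+* ℂ) (hj : ∀ z : ℂ, j (Complex.exp z) = Complex.exp (j z)) :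
    j (Real.pi : ℂ) = Real.pi ∨ j (Real.pi : ℂ) = -Real.pi := by
  rcases Summit.Schanuel.Schanuel.Theorems.map_two_pi_I_eq_or j hj with h | h
  · exact Summit.Schanuel.Schanuel.Theorems.map_pi_eq_or j h
  · have h' : ((starRingEnd ℂ).comp j) (2 * Real.pi * Complex.I) = 2 * Real.pi * Complex.I := by
      rw [RingHom.comp_apply, h, map_neg, map_mul, map_mul, map_ofNat, Complex.conj_ofReal,
        Complex.conj_I]
      ring
    rcases Summit.Schanuel.Schanuel.Theorems.map_pi_eq_or _ h' with h2 | h2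
    · left
      rw [RingHom.comp_apply] at h2
      rw [← Complex.conj_conj (j _), h2, Complex.conj_ofReal]
    · right
      rw [RingHom.comp_apply] at h2
      rw [← Complex.conj_conj (j _), h2, map_neg, Complex.conj_ofReal]

/-- Such an endomorphism maps the field `ℚ(π)` into itself. [folklore] -/
theorem map_mem_adjoin_pi (j : ℂ →+* ℂ)
    (hjπ : j (Real.pi : ℂ) = Real.pi ∨ j (Real.pi : ℂ) = -Real.pi) {x : ℂ}
    (hx : x ∈ adjoin ℚ ({(Real.pi : ℂ)} : Set ℂ)) : j x ∈ adjoin ℚ ({(Real.pi : ℂ)} : Set ℂ) := by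
  induction hx using IntermediateField.adjoin_induction with
  | mem x hx =>
    rw [Set.mem_singleton_iff] at hx
    subst hx
    rcases hjπ with h | h
    · rw [h]; exact mem_adjoin_simple_self ℚ _
    · rw [h]; exact neg_mem (mem_adjoin_simple_self ℚ _)
  | algebraMap q =>
    rw [show j (algebraMap ℚ ℂ q) = algebraMap ℚ ℂ q from j.toRatAlgHom.commutes q]
    exact IntermediateField.algebraMap_mem _ q
  | add x y _ _ hx hy => rw [map_add]; exact add_mem hx hy
  | inv x _ hx => rw [map_inv₀]; exact inv_mem hx
  | mul x y _ _ hx hy => rw [map_mul]; exact mul_mem hx hy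

/-- Transport: if `y` is algebraic over `ℚ(π)` then so is `j y`. [folklore] -/
theorem isAlgebraic_adjoin_pi_map (j : ℂ →+* ℂ)
    (hjπ : j (Real.pi : ℂ) = Real.pi ∨ j (Real.pi : ℂ) = -Real.pi) {y : ℂ}
    (hy : IsAlgebraic (adjoin ℚ ({(Real.pi : ℂ)} : Set ℂ)) y) :
    IsAlgebraic (adjoin ℚ ({(Real.pi : ℂ)} : Set ℂ)) (j y) := by
  set K := adjoin ℚ ({(Real.pi : ℂ)} : Set ℂ) with hK
  let σ : K →+* K :=
    { toFun := fun x => ⟨j x, map_mem_adjoin_pi j hjπ x.2⟩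
      map_one' := Subtype.ext (map_one j)
      map_mul' := fun a b => Subtype.ext (map_mul j _ _)
      map_zero' := Subtype.ext (map_zero j)
      map_add' := fun a b => Subtype.ext (map_add j _ _) }
  have hσ : Function.Injective σ := fun a b h =>
    Subtype.ext (j.injective (congrArg Subtype.val h))
  exact hy.ringHom_of_comp_eq σ j hσ (RingHom.ext fun _ => rfl)

/-- The orbit argument: if `j` is a ring endomorphism of `ℂ` and `α` is algebraic with
`jα ∉ {α, −α}`, then `(α, jα)` is `ℚ`-linearly independent — otherwise `jα = qα` with
`q ∈ ℚ ∖ {0, 1, −1}` and the `jⁿ α = qⁿ α` are infinitely many roots of the minimal polynomial of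
`α`. [folklore] -/
theorem linearIndependent_pair_of_map_ne (j : ℂ →+* ℂ) {α : ℂ} (hα : IsAlgebraic ℚ α)
    (h1 : j α ≠ α) (h2 : j α ≠ -α) : LinearIndependent ℚ ![α, j α] := by
  have hα0 : α ≠ 0 := by
    rintro rfl
    exact h1 (map_zero j)
  rw [LinearIndependent.pair_iff]
  intro s t hst
  by_contra hne
  have ht : t ≠ 0 := by
    intro ht
    subst ht
    simp only [zero_smul, add_zero, smul_eq_zero] at hst
    rcases hst with hs | hs
    · exact hne ⟨hs, rfl⟩
    · exact hα0 hs
  -- `jα = q α`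
  set q : ℚ := -s / t with hq
  have hjq : j α = (q : ℂ) * α := by
    have h0 : (s : ℂ) * α + (t : ℂ) * j α = 0 := by
      simpa only [Rat.smul_def] using hst
    have htC : (t : ℂ) ≠ 0 := by exact_mod_cast ht
    rw [hq]
    push_cast
    field_simp
    linear_combination h0
  have hq0 : q ≠ 0 := by
    intro h
    rw [h, Rat.cast_zero, zero_mul] at hjq
    exact hα0 (j.injective (hjq.trans (map_zero j).symm))
  have hq1 : q ≠ 1 := by
    intro h
    rw [h, Rat.cast_one, one_mul] at hjq
    exact h1 hjq
  have hq1' : q ≠ -1 := by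
    intro h
    rw [h, Rat.cast_neg, Rat.cast_one, neg_one_mul] at hjq
    exact h2 hjq
  -- the orbit `jⁿ α = qⁿ α`
  have horbit : ∀ n : ℕ, (⇑j)^[n] α = (q : ℂ) ^ n * α := by
    intro n
    induction n with
    | zero => simp
    | succ n ih =>
      rw [Function.iterate_succ_apply', ih, map_mul, map_pow, map_ratCast, hjq]
      ring
  -- every point of the orbit is a root of the minimal polynomial of `α`
  set p : Polynomial ℚ := minpoly ℚ α with hp
  have hp0 : p ≠ 0 := minpoly.ne_zero hα.isIntegral
  have hroot : ∀ n : ℕ, Polynomial.aeval ((⇑j)^[n] α) p = 0 := by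
    intro n
    induction n with
    | zero => rw [Function.iterate_zero_apply, hp]; exact minpoly.aeval ℚ α
    | succ n ih =>
      rw [Function.iterate_succ_apply', show j ((⇑j)^[n] α) = j.toRatAlgHom ((⇑j)^[n] α) from rfl,
        Polynomial.aeval_algHom_apply, ih, map_zero]
  -- the orbit is infinite: `n ↦ qⁿ α` is injective since `|q| ≠ 1`, `q ≠ 0`
  have hinj : Function.Injective (fun n : ℕ => (q : ℂ) ^ n * α) := by
    have hnorm : Function.Injective (fun n : ℕ => |(q : ℝ)| ^ n) := by
      rcases lt_or_gt_of_ne (show |(q : ℝ)| ≠ 1 by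
        intro h
        rcases abs_eq (zero_le_one) |>.1 h with h' | h'
        · exact hq1 (by exact_mod_cast h')
        · exact hq1' (by exact_mod_cast h')) with hlt | hgt
      · exact (pow_right_strictAnti₀ (abs_pos.2 (by exact_mod_cast hq0)) hlt).injective
      · exact (pow_right_strictMono₀ hgt).injective
    intro a b hab
    have h' : ‖(q : ℂ) ^ a * α‖ = ‖(q : ℂ) ^ b * α‖ := congrArg (‖·‖) hab
    simp only [norm_mul, norm_pow] at h'
    have hαn : ‖α‖ ≠ 0 := norm_ne_zero_iff.2 hα0
    have h'' : ‖(q : ℂ)‖ ^ a = ‖(q : ℂ)‖ ^ b := mul_right_cancel₀ hαn h'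
    rw [Complex.norm_ratCast] at h''
    exact hnorm h''
  have hinf : Set.Infinite {x : ℂ | (p.map (algebraMap ℚ ℂ)).IsRoot x} := by
    refine Set.infinite_of_injective_forall_mem hinj (fun n => ?_)
    show (p.map (algebraMap ℚ ℂ)).IsRoot ((q : ℂ) ^ n * α)
    rw [Polynomial.IsRoot, Polynomial.eval_map, ← Polynomial.aeval_def, ← horbit n, hroot n]
  have hp' : p.map (algebraMap ℚ ℂ) = 0 := Polynomial.eq_zero_of_infinite_isRoot _ hinf
  rw [Polynomial.map_eq_zero_iff (algebraMap ℚ ℂ).injective] at hp'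
  exact hp0 hp'

end EndoCriterion

/-- **Registered calibration stub `stub_endomorphismCriterion` of line `sector-split`** —
signature verbatim; it is LITERALLY the support item stmt-Schanuel-9550
`ExceptionalSubspaces.EndomorphismCriterion`: if `α` is algebraic and a ring endomorphism `j` of
`ℂ` commuting with `exp` has `jα ∉ {α, −α}`, then `π` and `e^α` are algebraically independent.
[folklore] -/
theorem stub_endomorphismCriterion :
    ∀ α : ℂ, IsAlgebraic ℚ α → ∀ j : ℂ →+* ℂ, (∀ z : ℂ, j (Complex.exp z) = Complex.exp (j z)) →
      j α ≠ α → j α ≠ -α → AlgebraicIndependent ℚ ![(Real.pi : ℂ), Complex.exp α] := by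
  intro α hα j hj h1 h2
  have hli := EndoCriterion.linearIndependent_pair_of_map_ne j hα h1 h2
  have hjα : IsAlgebraic ℚ (j α) := hα.algHom j.toRatAlgHom
  by_contra hdep
  have hy : IsAlgebraic (adjoin ℚ ({(Real.pi : ℂ)} : Set ℂ)) (Complex.exp α) := by
    have h := mt KernelTower.algebraicIndependent_pi_pair_iff.2 hdep
    simpa [Transcendental] using h
  have hy' : IsAlgebraic (adjoin ℚ ({(Real.pi : ℂ)} : Set ℂ)) (Complex.exp (j α)) := by
    rw [← hj]
    exact EndoCriterion.isAlgebraic_adjoin_pi_map j (EndoCriterion.map_pi_eq_or j hj) hy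
  exact KernelTower.not_isAlgebraic_adjoin_pi_exp_pair α (j α) hα hjα hli ⟨hy, hy'⟩

/-- The support item stmt-Schanuel-9550 of route ExceptionalSubspaces holds:
`ExceptionalSubspaces.EndomorphismCriterion`. [folklore] -/
theorem EndoCriterion.endomorphismCriterion : ExceptionalSubspaces.EndomorphismCriterion :=
  stub_endomorphismCriterion

/-- The support item stmt-Schanuel-9555 `ExceptionalSubspaces.DOneGlue` (pure logic): the `d = 1`
layer of the π–LW residue from the endomorphism criterion, realised Galois orbits and the
real-abelian residue — case split on whether `α²` is real-abelian. [folklore] -/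
theorem EndoCriterion.dOneGlue : ExceptionalSubspaces.DOneGlue := by
  intro hE hG hR α hα hα0
  by_cases hab : ((α ^ 2).im = 0 ∧ ∃ n : ℕ, 0 < n ∧
      α ^ 2 ∈ IntermediateField.adjoin ℚ ({Complex.exp (2 * Real.pi * Complex.I / n)} : Set ℂ))
  · exact hR α hα hα0 hab
  · obtain ⟨j, hj, h1, h2⟩ := hG α hα hab
    exact hE α hα j hj h1 h2

/-- Hence, unconditionally in the endomorphism criterion: the `d = 1` layer of the π–LW residue
(`π ⊥ e^α` for every non-zero algebraic `α`) follows from the two OPEN cruxes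
`GaloisOrbitRealised` (stmt-Schanuel-9546) and `RealAbelianResidue` (stmt-Schanuel-9547) alone.
(Conditional: both hypotheses are open.) [folklore] -/
theorem EndoCriterion.dOne_of_orbit_of_residue (hG : ExceptionalSubspaces.GaloisOrbitRealised)
    (hR : ExceptionalSubspaces.RealAbelianResidue) :
    ∀ α : ℂ, IsAlgebraic ℚ α → α ≠ 0 → AlgebraicIndependent ℚ ![(Real.pi : ℂ), Complex.exp α] :=
  EndoCriterion.dOneGlue stub_endomorphismCriterion hG hR

end Summit.Schanuel.Schanuel.Theorems.RigidCore

end
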